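import Summits.CriticalPhenomena.PercolationContinuityZ3.Theorems.PercNearOneGluingNoHeavyLowerTailSahiMixtureHMixFourCanon

/-!
# H-MIX(4): the sixteen three-slot cells of canonical type `({0},{1},{2})` — `CanonThreeSlotCells 0`

Support file of the one-cut programme (crux `NoHeavyLowerTail`, stmt-CriticalPhenomena-4575; cell `prim-masterthm`, seat P3, gen 7;
`run/shared/lean/prim/prim-masterthm/prim-masterthm-p3/HIERARCHY.md` §14).  For a probability weight `μ`, a hereditarily all-orders-positive quadruple
`A : Fin 4 → Set α` and `F : Fin 4 → Bool`, the row `h ↦ E_3(μ⊗coin(h); (1_{⋂_{i∈K_j}(A_i ∪ [F i]·H)})_j)` over the canonical index triple `K = ({0},{1},{2})`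
is Bernstein-positive of degree `3`, for each of the sixteen `F`: 16 PLAIN cells (`F` constant on every slot:
`…SahiMixtureFourAtoms.bernsteinPos_threeSlot_plain`) and 0 certified cells (`threeSlot_k0_F…`: slots rewritten as `mixEv (A_K) (A_{K∖F})`, the
four Bernstein coefficients of `sahiE_three_mixEv_eq` supplied by the hereditary rows `E_3(A_K·)`, `E_3(A_{K∖F}·)` and by the polynomial certificates of
`…SahiMixtureFourCertK0*` evaluated at the Venn atoms `atom4`).  Result: **`canonThreeSlotCells_zero : CanonThreeSlotCells 0`**.
HONEST FRAMING: one quarter of the three-slot part of H-MIX(4); the assembly is `…SahiMixtureHMixFourCanon.hereditaryMixture_four_of_canonCells`. [this work]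
-/

noncomputable section

open scoped Classical

namespace Summit.CriticalPhenomena.PercolationContinuityZ3.Theorems

open Finset Function
open Literature.Combinatorics.Sahi2008
open Literature.Probability.Percolation.DecisionTree (ind ind_of_mem ind_of_not_mem ind_nonneg)

namespace SahiMixture

/-- **`CanonThreeSlotCells 0`**: all sixteen three-slot cells of canonical type `({0},{1},{2})` (case split on `F`; plain cells by `bernsteinPos_threeSlot_plain`, the others by the certified cells above). [this work] -/
theorem canonThreeSlotCells_zero : CanonThreeSlotCells 0 := by
  intro α _ μ hμ hμ1 A hA F
  have hF : F = ![F 0, F 1, F 2, F 3] := by funext i; fin_cases i <;> rfl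
  rw [hF, canonK_zero]
  cases F 0 <;> cases F 1 <;> cases F 2 <;> cases F 3
  · exact bernsteinPos_threeSlot_plain A _ hμ hμ1 hA _ ![false, false, false] (by decide)
  · exact bernsteinPos_threeSlot_plain A _ hμ hμ1 hA _ ![false, false, false] (by decide)
  · exact bernsteinPos_threeSlot_plain A _ hμ hμ1 hA _ ![false, false, true] (by decide)
  · exact bernsteinPos_threeSlot_plain A _ hμ hμ1 hA _ ![false, false, true] (by decide)
  · exact bernsteinPos_threeSlot_plain A _ hμ hμ1 hA _ ![false, true, false] (by decide)
  · exact bernsteinPos_threeSlot_plain A _ hμ hμ1 hA _ ![false, true, false] (by decide)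
  · exact bernsteinPos_threeSlot_plain A _ hμ hμ1 hA _ ![false, true, true] (by decide)
  · exact bernsteinPos_threeSlot_plain A _ hμ hμ1 hA _ ![false, true, true] (by decide)
  · exact bernsteinPos_threeSlot_plain A _ hμ hμ1 hA _ ![true, false, false] (by decide)
  · exact bernsteinPos_threeSlot_plain A _ hμ hμ1 hA _ ![true, false, false] (by decide)
  · exact bernsteinPos_threeSlot_plain A _ hμ hμ1 hA _ ![true, false, true] (by decide)
  · exact bernsteinPos_threeSlot_plain A _ hμ hμ1 hA _ ![true, false, true] (by decide)
  · exact bernsteinPos_threeSlot_plain A _ hμ hμ1 hA _ ![true, true, false] (by decide)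
  · exact bernsteinPos_threeSlot_plain A _ hμ hμ1 hA _ ![true, true, false] (by decide)
  · exact bernsteinPos_threeSlot_plain A _ hμ hμ1 hA _ ![true, true, true] (by decide)
  · exact bernsteinPos_threeSlot_plain A _ hμ hμ1 hA _ ![true, true, true] (by decide)

end SahiMixture

end Summit.CriticalPhenomena.PercolationContinuityZ3.Theorems

end
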